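import Literature.Computability.Complexity.StackGcd
import HarnessLib

/-!
# Verified arithmetic on stack programs: quotient and remainder (binary long division)

Trunk `CplxCore`, toolkit continuing `StackGcd.lean` (`remStep`/`remOf`: the remainder of an
outer register by the bank modulus). Here the same long division also records the **quotient**:
`Com.divStep b q` performs `x := (2x + b) mod y` and pushes the quotient bit (`1` iff the
conditional subtraction took place) onto the outer register `q`; `Com.divOf m q` runs it over
the bits of the dividend register `m` (most significant bit first, consumed), leaving the
remainder in `x` and the quotient, least significant bit first (the tree's numeral order, up to
redundant high zeros), in `q` (`runs_divOf`, `divOf_spec`: `dividend = quotient · y + x`,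
`x < y`).

## References

* D. E. Knuth, *The Art of Computer Programming*, Vol. 2, 3rd ed., Addison-Wesley 1998, §4.3.1,
  Algorithm D (here radix 2). (Not held; schoolbook long division, fully proved here.)
* T. H. Cormen, C. E. Leiserson, R. L. Rivest, C. Stein, *Introduction to Algorithms*, MIT Press
  (3rd ed. 2009), §31.1 (division theorem, Thm. 31.1).
-/

namespace Literature.Computability.Complexity

open _root_.Computability AReg

namespace Com

section Div

variable {κ : Type} [DecidableEq κ]

/-- One step of binary long division with quotient: `x := (2x + b) mod y` on the bank and the
quotient bit pushed onto the outer register `q`. [folklore] -/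
def divStep (b : Bool) (q : κ) : Com (κ ⊕ AReg) :=
  bk (push .x b) ;; (bk sub ;;
    (pop (Sum.inr .g) (push (Sum.inl q) true) skip (push (Sum.inl q) false) ;; bk normalize))

/-- The quotient bit of a division step: `1` iff `2x + b ≥ y`. [folklore] -/
def divBit (b : Bool) (acc n : List Bool) : Bool := !subBorrow (b :: acc) n

/-- The quotient bit decides `y ≤ 2x + b`. [folklore] -/
theorem divBit_iff (b : Bool) (acc n : List Bool) :
    divBit b acc n = decide (bitsToNat n ≤ 2 * bitsToNat acc + b.toNat) := by
  rw [divBit, subBorrow_iff]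
  have h2 : bitsToNat (b :: acc) = 2 * bitsToNat acc + b.toNat := by simp; ring
  rw [h2]
  by_cases h : bitsToNat n ≤ 2 * bitsToNat acc + b.toNat
  · simp [h]
  · simp [h]; omega

/-- **Simulation of a division step**: the bank as after `remStep`, the bit `divBit` pushed on
`q`; cost `25|x| + 16|y| + 46`. [folklore] -/
theorem runs_divStep (b : Bool) (q : κ) (T : Regs κ) (acc n zz : List Bool) :
    Runs (divStep b q) (Sum.elim T (file acc n zz [] [] [] [] []))
      (Sum.elim (Function.update T q (divBit b acc n :: T q)) (file (remStepRes b acc n) n zz [] [] [] [] []))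
      (25 * acc.length + 16 * n.length + 46) := by
  have h1 : Runs (bk (push .x b) : Com (κ ⊕ AReg)) (Sum.elim T (file acc n zz [] [] [] [] []))
      (Sum.elim T (file (b :: acc) n zz [] [] [] [] [])) 1 := Runs.push' (by simp)
  have h2 := (runs_sub (b :: acc) n zz).inr T
  set raw := (bif subBorrow (b :: acc) n then b :: acc else subRes (b :: acc) n) with hraw
  have hraw' : raw = remStepRaw b acc n := rfl
  have h3 : Runs (pop (Sum.inr .g) (push (Sum.inl q) true) skip (push (Sum.inl q) false) : Com (κ ⊕ AReg))
      (Sum.elim T (file raw n zz [] [] [] [] (flag !subBorrow (b :: acc) n)))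
      (Sum.elim (Function.update T q (divBit b acc n :: T q)) (file raw n zz [] [] [] [] [])) 3 := by
    rw [divBit]
    cases hb : subBorrow (b :: acc) n
    · refine Runs.pop_true' _ _ (w := []) (by simp) (by rfl) ((Runs.push' ?_).mono (by omega))
      simp [-Sum.elim_update_left, -Sum.elim_update_right]
    · refine (Runs.pop_nil _ _ (by simp) (Runs.push' ?_)).of_eq rfl (by omega)
      simp [-Sum.elim_update_left, -Sum.elim_update_right]
  have h4 := (runs_normalize raw n zz [] [] []).inr (Function.update T q (divBit b acc n :: T q))
  refine (h1.seq (h2.seq (h3.seq h4))).of_eq (by rw [remStepRes, ← hraw']) ?_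
  rw [hraw', length_remStepRaw, List.length_cons]; omega

/-- `divOf m q`: **binary long division** of the outer register `m` (dividend, most significant
bit first, consumed) by `y`: remainder steps on the bank, quotient bits pushed onto `q` (so the
quotient ends least significant bit first on top of `q`). [folklore] -/
def divOf (m q : κ) : Com (κ ⊕ AReg) := loop (Sum.inl m) (divStep true q) (divStep false q)

/-- Model of the quotient register: the quotient bits pushed over the run (newest first).
[folklore] -/
def divBits : List Bool → List Bool → List Bool → List Bool → List Bool
  | [], _, _, qs => qs
  | b :: bs, acc, n, qs => divBits bs (remStepRes b acc n) n (divBit b acc n :: qs)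

/-- **The division identity**: after the run, `quotient · n + remainder` equals the dividend
combined with the initial accumulator, the quotient being the pushed bits read as a numeral
(least significant bit first) on top of the initial ones. [cite: CLRS2009, §31.1 (Thm. 31.1, division theorem)] -/
theorem divBits_spec : ∀ (bs acc n qs : List Bool), bitsToNat acc < bitsToNat n →
    bitsToNat (divBits bs acc n qs) * bitsToNat n + bitsToNat (remOfRes bs acc n) =
      (bitsToNat qs * bitsToNat n + bitsToNat acc) * 2 ^ bs.length + bitsToNat bs.reverse
  | [], acc, n, qs, _ => by simp [divBits, remOfRes]
  | b :: bs, acc, n, qs, h => by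
    have hstep := bitsToNat_remStepRes b acc n h
    have hlt := bitsToNat_remStepRes_lt b acc n h
    rw [divBits, remOfRes, divBits_spec bs _ n _ hlt, List.reverse_cons, bitsToNat_append, List.length_reverse,
      List.length_cons, bitsToNat_cons, bitsToNat_cons, bitsToNat_nil, divBit_iff, hstep, pow_succ]
    simp only [mul_zero, add_zero]
    by_cases hle : bitsToNat n ≤ 2 * bitsToNat acc + b.toNat
    · have hb : b.toNat ≤ 1 := Bool.toNat_le b
      have hlt2 : 2 * bitsToNat acc + b.toNat < 2 * bitsToNat n := by omega
      rw [decide_eq_true hle, Bool.toNat_true, Nat.mod_eq_sub_mod hle, Nat.mod_eq_of_lt (by omega)]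
      have : (1 + 2 * bitsToNat qs) * bitsToNat n + (2 * bitsToNat acc + b.toNat - bitsToNat n) =
          2 * (bitsToNat qs * bitsToNat n + bitsToNat acc) + b.toNat := by
        zify [hle]; ring
      rw [this]; ring
    · rw [decide_eq_false hle, Bool.toNat_false, Nat.mod_eq_of_lt (by omega)]
      ring

/-- **Simulation of `divOf`**: with `T m = bs`, `x = acc < y = n`, `|acc| ≤ |n|`, the loop
empties `m`, leaves `remOfRes bs acc n` in `x` and pushes the quotient bits onto `q`, in
`|bs| · (41|n| + 48) + 1` steps. [folklore] -/
theorem runs_divOf {m q : κ} (hmq : m ≠ q) : ∀ (bs : List Bool) (T : Regs κ) (acc n zz : List Bool),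
    T m = bs → bitsToNat acc < bitsToNat n → acc.length ≤ n.length →
      Runs (divOf m q) (Sum.elim T (file acc n zz [] [] [] [] []))
        (Sum.elim (Function.update (Function.update T m []) q (divBits bs acc n (T q)))
          (file (remOfRes bs acc n) n zz [] [] [] [] []))
        (bs.length * (41 * n.length + 48) + 1)
  | [], T, acc, n, zz, hT, _, _ => by
    refine (Runs.loop_nil _ _ (by simp [hT])).of_eq ?_ (by simp)
    rw [remOfRes, divBits]
    have e1 : Function.update T m ([] : List Bool) = T := Function.update_eq_self_iff.2 hT.symm
    rw [e1, Function.update_eq_self]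
  | b :: bs, T, acc, n, zz, hT, h, hl => by
    have hk : (Sum.elim T (file acc n zz [] [] [] [] []) : Regs (κ ⊕ AReg)) (Sum.inl m) = b :: bs := by simp [hT]
    have hbody : ∀ b' : Bool, Runs (divStep b' q)
        (Function.update (Sum.elim T (file acc n zz [] [] [] [] []) : Regs (κ ⊕ AReg)) (Sum.inl m) bs)
        (Sum.elim (Function.update (Function.update T m bs) q (divBit b' acc n :: T q))
          (file (remStepRes b' acc n) n zz [] [] [] [] [])) (41 * n.length + 46) := fun b' => by
      rw [Sum.update_elim_inl]
      exact (runs_divStep b' q (Function.update T m bs) acc n zz).of_eq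
        (by simp [-Sum.elim_update_left, -Sum.elim_update_right, hmq.symm]) (by nlinarith [hl])
    have hrest := runs_divOf hmq bs (Function.update (Function.update T m bs) q (divBit b acc n :: T q))
      (remStepRes b acc n) n zz (by simp [hmq]) (bitsToNat_remStepRes_lt b acc n h) (length_remStepRes_le b acc n h)
    have hfin : Function.update (Function.update (Function.update (Function.update T m bs) q (divBit b acc n :: T q)) m [])
        q (divBits bs (remStepRes b acc n) n ((Function.update (Function.update T m bs) q (divBit b acc n :: T q)) q)) =
        Function.update (Function.update T m []) q (divBits (b :: bs) acc n (T q)) := by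
      rw [divBits]
      funext k
      by_cases h1 : k = q
      · subst h1; simp
      · by_cases h2 : k = m
        · subst h2; simp [hmq]
        · simp [h1, h2]
    rw [hfin] at hrest
    cases b
    · exact (Runs.loop_false hk (hbody false) hrest).of_eq rfl (by simp; ring_nf; omega)
    · exact (Runs.loop_true hk (hbody true) hrest).of_eq rfl (by simp; ring_nf; omega)

/-- **`divOf` from zero divides**: with `x = 0` and `q` empty, afterwards
`bin⁻¹ q · n + bin⁻¹ x = bin⁻¹ (reverse m)` and `bin⁻¹ x < n`. [cite: CLRS2009, §31.1 (Thm. 31.1, division theorem)] -/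
theorem divOf_spec (bs n : List Bool) (hn : 0 < bitsToNat n) :
    bitsToNat (divBits bs [] n []) * bitsToNat n + bitsToNat (remOfRes bs [] n) = bitsToNat bs.reverse ∧
      bitsToNat (remOfRes bs [] n) < bitsToNat n := by
  refine ⟨?_, (remOfRes_lt_and_length bs [] n (by simpa using hn) (by simp)).1⟩
  have := divBits_spec bs [] n [] (by simpa using hn)
  simpa using this

/-- Hence the quotient register holds `⌊m / n⌋` and `x` holds `m mod n`. [folklore] -/
theorem divOf_div_mod (bs n : List Bool) (hn : 0 < bitsToNat n) :
    bitsToNat (divBits bs [] n []) = bitsToNat bs.reverse / bitsToNat n ∧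
      bitsToNat (remOfRes bs [] n) = bitsToNat bs.reverse % bitsToNat n := by
  obtain ⟨h1, h2⟩ := divOf_spec bs n hn
  constructor
  · rw [← h1, Nat.add_comm, Nat.add_mul_div_right _ _ hn, Nat.div_eq_of_lt h2, zero_add]
  · rw [← h1, Nat.add_comm, Nat.add_mul_mod_self_right, Nat.mod_eq_of_lt h2]

end Div

end Com
end Literature.Computability.Complexity
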